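import Summits.Ventures.Crystal3D.Theorems.StickyWulffConstantTextureLiminfTexShadowFreeGlue
import Summits.Ventures.Crystal3D.Theorems.StickyWulffConstantTextureLiminfTexShadowResLastDefs
import HarnessLib

/-!
# TexShadow v8.2 — «BothFcc-FIRST, RES-LAST» glue: `BilayerWallV5` from F-U, lane G's charge-`13/25` ledger, the two v8 faulted stubs and
# the faulted residual CORE (lane T, crux `TextureLiminfV5`, stmt-Ventures-23912; cf-p1 DECISION (xc)(1), 2026-08-29T02:24:26Z)

HONEST FRAMING. Venture `Summits/Ventures/Crystal3D` (cell `crystal3d-full`), route `route-Ventures-StickyWulffConstant`, helper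
`--supports` the law-v5 crux `TextureLiminfV5` (stmt-Ventures-23912).  Pure bookkeeping (census-free, standard axioms); every wall input is
a HYPOTHESIS; rung F-C1 not moved.

THE CUT.  The four-way tree runs FIRST in its `hgen`-free form (…TexShadowFreeGlue p689088: frames-free closed parts `walkerCoveredFree_of_F4` /
`rowCovFree_framesApart` / `zigFramesApartFree_of_cert`, `onReachAllFreeAt_of_split`, `allAt_of_four_min`); every OWED leaf is then served
three ways — `BothFcc` ⇒ the closed `BothFcc` half (zero cell / F-U / hG); faulted WITHOUT a residual-class frame pair ⇒ the registered v8
stub (`hgen` form); faulted WITH one ⇒ the residual CORE stub (…ResLastDefs) — so `RES` is tested LAST and only where something is owed: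
* lifts `onReachCoaxialFreeAt_of_resLast`, `zigCoaxialFreeAt_of_resLast`, `deficitMinFreeAt_of_resLast`;
* **`bilayerWallCharged_of_stubsResLast`** (`0 ≤ c₀ ≤ 1`, `R₀ ≥ 10`) and, under the name TexShadow v8.2 expects,
  **`bilayerWallV5_of_stubsResLast : E1-data → StarPairFar facts → 10 ≤ R₀ → (∃ C, CoaxialUnifAt C R₀) →
  (∃ K, ∀ P₁ t₁ P₂ t₂, ¬(affine coax) → GenericWallFloorWithCharge K R₀ (13/25) P₁ t₁ P₂ t₂) →
  ((∃ C, …FaultedOnReachCoaxialAt (13/25) C R₀) ∧ (∃ C, …FaultedZigCoaxialAt (13/25) C R₀)) → (∃ C, HStripPayerPoolFaultedAt (13/25) C R₀) →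
  (∃ C, BilayerWallResidualFaultedCoreAt (13/25) C R₀) → BilayerWallV5`**.
v8.2 stubs: l12Local, barlowAdhesionR, E1, starPairFar, coaxialUnif, coverage, famFaulted, hStripPayerPoolFaulted, residualFaultedCore,
textureBuild (ten; the residual stub is the honest core).
WHAT THIS IS NOT: no proof of F-U, of lane G's ledger, of T-F2, of the pool or of the core; F-C1 not moved.
-/

noncomputable section

namespace Summit.Ventures.Crystal3D.Cruxes.TextureLiminf.TexShadow

open Summit.Ventures.Crystal3D Summit.Ventures.Crystal3D.Theorems Finset TentCertificate
open Literature.MathematicalPhysics.StatisticalMechanics (IsHaggSeq fccStacking barlowStacking basalMirror)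
open scoped InnerProductSpace

/-! ## Lifts with the residual test inside the leaf -/

open scoped Classical in
/-- **O3 (free) at cap `c₀` from three sources**: the `BothFcc` half, the v8 corner-keyed T-F2 stub (faulted, `hgen`), the residual core
(faulted, `RES`, corner leaf). -/
theorem onReachCoaxialFreeAt_of_resLast {c₀ R₀ C_B C_f C_r : ℝ} (hR₀0 : 0 ≤ R₀) (hB : BilayerWallBothFccAt c₀ C_B R₀)
    (hf : BilayerWallFaultedOnReachCoaxialAt c₀ C_f R₀) (hr : BilayerWallResidualFaultedCoreAt c₀ C_r R₀) :
    BilayerWallOnReachCoaxialFreeAt c₀ (max C_B (max C_f C_r)) R₀ := by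
  intro σ₁ σ₂ hσ₁ hσ₂ L₁ L₂ s₁ s₂ A₁ A₂ u₁ u₂ hA₁ hA₂ c m hadm hdom hcl
  by_cases hfcc : BothFcc σ₁ σ₂
  · exact bilayerWallAt_mono hR₀0 (le_max_left _ _) (hB σ₁ σ₂ hσ₁ hσ₂ hfcc L₁ L₂ s₁ s₂ A₁ A₂ u₁ u₂ hA₁ hA₂ c m hadm)
  · by_cases hres : ∃ i j : ℤ, InResidualClass (A₁ i) (A₂ j) (u₁ i) (u₂ j)
    · exact bilayerWallAt_mono hR₀0 ((le_max_right _ _).trans (le_max_right _ _))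
        (hr σ₁ σ₂ hσ₁ hσ₂ hfcc L₁ L₂ s₁ s₂ A₁ A₂ u₁ u₂ hA₁ hA₂ hres c m hadm (Or.inl ⟨hdom, hcl⟩))
    · exact bilayerWallAt_mono hR₀0 ((le_max_left _ _).trans (le_max_right _ _))
        (hf σ₁ σ₂ hσ₁ hσ₂ hfcc L₁ L₂ s₁ s₂ A₁ A₂ u₁ u₂ hA₁ hA₂ (fun i j h => hres ⟨i, j, h⟩) c m hadm hdom hcl)

open scoped Classical in
/-- **ZO3 (free) at cap `c₀` from three sources**: the `BothFcc` half, the v8 zig-keyed T-F2 stub, the residual core (zig leaf). -/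
theorem zigCoaxialFreeAt_of_resLast {c₀ R₀ C_B C_f C_r : ℝ} (hR₀0 : 0 ≤ R₀) (hB : BilayerWallBothFccAt c₀ C_B R₀)
    (hf : BilayerWallFaultedZigCoaxialAt c₀ C_f R₀) (hr : BilayerWallResidualFaultedCoreAt c₀ C_r R₀) :
    BilayerWallZigCoaxialFreeAt c₀ (max C_B (max C_f C_r)) R₀ := by
  intro σ₁ σ₂ hσ₁ hσ₂ L₁ L₂ s₁ s₂ A₁ A₂ u₁ u₂ hA₁ hA₂ c m hadm hΔ₁ hΔ₂ hfl hoff hrow hzg hcl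
  by_cases hfcc : BothFcc σ₁ σ₂
  · exact bilayerWallAt_mono hR₀0 (le_max_left _ _) (hB σ₁ σ₂ hσ₁ hσ₂ hfcc L₁ L₂ s₁ s₂ A₁ A₂ u₁ u₂ hA₁ hA₂ c m hadm)
  · by_cases hres : ∃ i j : ℤ, InResidualClass (A₁ i) (A₂ j) (u₁ i) (u₂ j)
    · exact bilayerWallAt_mono hR₀0 ((le_max_right _ _).trans (le_max_right _ _))
        (hr σ₁ σ₂ hσ₁ hσ₂ hfcc L₁ L₂ s₁ s₂ A₁ A₂ u₁ u₂ hA₁ hA₂ hres c m hadm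
          (Or.inr (Or.inl ⟨hΔ₁, hΔ₂, hfl, hoff, hrow, hzg, hcl⟩)))
    · exact bilayerWallAt_mono hR₀0 ((le_max_left _ _).trans (le_max_right _ _))
        (hf σ₁ σ₂ hσ₁ hσ₂ hfcc L₁ L₂ s₁ s₂ A₁ A₂ u₁ u₂ hA₁ hA₂ (fun i j h => hres ⟨i, j, h⟩) c m hadm
          hΔ₁ hΔ₂ hfl hoff hrow hzg hcl)

open scoped Classical in
/-- **Deficit-MIN (free) at cap `c₀` from three sources**, `R₀ ≥ 3`: the `BothFcc` half, the v8 faulted payer pool (`bilayerWallAt_of_payerBound`),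
the residual core (pool leaf). -/
theorem deficitMinFreeAt_of_resLast {c₀ R₀ C_B C_r : ℝ} (hR3 : 3 ≤ R₀) (hB : BilayerWallBothFccAt c₀ C_B R₀)
    (hPool : ∃ C : ℝ, HStripPayerPoolFaultedAt c₀ C R₀) (hr : BilayerWallResidualFaultedCoreAt c₀ C_r R₀) :
    ∃ C : ℝ, BilayerWallDeficitMinFreeAt c₀ C R₀ := by
  obtain ⟨C, hpool⟩ := hPool
  refine ⟨max C_B (max ((C + 3456 + 1152 * (R₀ + 1)) / 2) C_r), ?_⟩
  intro σ₁ σ₂ hσ₁ hσ₂ L₁ L₂ s₁ s₂ A₁ A₂ u₁ u₂ hA₁ hA₂ c m hadm hZ hR₁ hR₂ hR₃' hR₄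
  have hR₀0 : 0 ≤ R₀ := by linarith
  by_cases hfcc : BothFcc σ₁ σ₂
  · exact bilayerWallAt_mono hR₀0 (le_max_left _ _) (hB σ₁ σ₂ hσ₁ hσ₂ hfcc L₁ L₂ s₁ s₂ A₁ A₂ u₁ u₂ hA₁ hA₂ c m hadm)
  · by_cases hres : ∃ i j : ℤ, InResidualClass (A₁ i) (A₂ j) (u₁ i) (u₂ j)
    · exact bilayerWallAt_mono hR₀0 ((le_max_right _ _).trans (le_max_right _ _))
        (hr σ₁ σ₂ hσ₁ hσ₂ hfcc L₁ L₂ s₁ s₂ A₁ A₂ u₁ u₂ hA₁ hA₂ hres c m hadm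
          (Or.inr (Or.inr ⟨hZ, hR₁, hR₂, hR₃', hR₄⟩)))
    · exact bilayerWallAt_mono hR₀0 ((le_max_left _ _).trans (le_max_right _ _))
        (bilayerWallAt_of_payerBound hσ₁ hσ₂ L₁ L₂ s₁ s₂ R₀ C hR3 c
          (hpool σ₁ σ₂ hσ₁ hσ₂ hfcc L₁ L₂ s₁ s₂ A₁ A₂ u₁ u₂ hA₁ hA₂ (fun i j h => hres ⟨i, j, h⟩) c m hadm
            hZ hR₁ hR₂ hR₃' hR₄))

/-! ## The composition, `RES` last -/

/-- **The wall law at cap `c₀` (`0 ≤ c₀ ≤ 1`, `R₀ ≥ 10`) from the v8.2 inputs**: E1-data + StarPairFar facts, F-U, lane G's uniform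
deficiency-form charge-`c₀` ledger, the two v8 faulted T-F2 stubs, the v8 faulted payer pool, and the faulted residual CORE. -/
theorem bilayerWallCharged_of_stubsResLast
    {sE : E3} (hsE : sE ∈ fccSlots) (hcert : ExactOnly 0 (fccSlots.filter fun w => 0 < ⟪w, sE⟫_ℝ))
    (hDS : ∀ F₁ F₂ : E3 ≃ₗᵢ[ℝ] E3, DoubleStarCoaxialAt F₁ F₂) (hCP : CapPairCoaxial) {c₀ R₀ : ℝ} (hc₀ : 0 ≤ c₀) (hc₁ : c₀ ≤ 1)
    (h10 : 10 ≤ R₀) (hF : ∃ C : ℝ, CoaxialUnifAt C R₀)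
    (hG : ∃ K : ℝ, ∀ (P₁ : E3 ≃ₗᵢ[ℝ] E3) (t₁ : E3) (P₂ : E3 ≃ₗᵢ[ℝ] E3) (t₂ : E3),
      ¬ (∃ (L : E3 ≃ₗᵢ[ℝ] E3) (r₁ r₂ : E3) (σ σ' : ℤ → ℤ), IsHaggSeq σ ∧ IsHaggSeq σ' ∧
        (fun p => P₁ p + t₁) '' fccStacking 1 (Real.sqrt (2 / 3)) ⊆
          (fun p => L p + r₁) '' barlowStacking 1 (Real.sqrt (2 / 3)) σ ∧
        (fun p => P₂ p + t₂) '' fccStacking 1 (Real.sqrt (2 / 3)) ⊆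
          (fun p => L p + r₂) '' barlowStacking 1 (Real.sqrt (2 / 3)) σ') →
      GenericWallFloorWithCharge K R₀ c₀ P₁ t₁ P₂ t₂)
    (hFault : (∃ C : ℝ, BilayerWallFaultedOnReachCoaxialAt c₀ C R₀) ∧ (∃ C : ℝ, BilayerWallFaultedZigCoaxialAt c₀ C R₀))
    (hPool : ∃ C : ℝ, HStripPayerPoolFaultedAt c₀ C R₀) (hRes : ∃ C : ℝ, BilayerWallResidualFaultedCoreAt c₀ C R₀) :
    BilayerWallCharged c₀ := by
  have hR₀6 : 6 ≤ R₀ := by linarith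
  have hR₀0 : 0 ≤ R₀ := by linarith
  obtain ⟨C_B, hB⟩ := bothFccAt_of_withCharge hc₀ hc₁ (by linarith) hF hG
  obtain ⟨⟨C_f, hf⟩, ⟨C_z, hz⟩⟩ := hFault
  obtain ⟨C_r, hr⟩ := hRes
  obtain ⟨C_W, hW⟩ := walkerCoveredFree_of_F4 hsE hcert hDS hCP hR₀6
  obtain ⟨C_R, hR⟩ := rowCovFree_framesApart hsE hcert hDS hCP hR₀6
  obtain ⟨C_A, hA⟩ := zigFramesApartFree_of_cert hsE hcert hDS hCP hR₀6
  have hO := onReachAllFreeAt_of_split hR₀0 hR hA (onReachCoaxialFreeAt_of_resLast hR₀0 hB hf hr)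
    (onReachWeakZigFreeAt_of_zigSplit hR₀0 hA (zigCoaxialFreeAt_of_resLast hR₀0 hB hz hr))
  obtain ⟨C_D, hD⟩ := deficitMinFreeAt_of_resLast (by linarith) hB hPool hr
  exact bilayerWallCharged_of_allAt (by linarith) (allAt_of_four_min hR₀0 hW hR hO hD)

/-- **`BilayerWallV5` from the TexShadow v8.2 inputs at one `R₀ ≥ 10`** (cf-p1 (xc)(1)): E1-data, the StarPairFar facts, F-U
(`∃ C, CoaxialUnifAt C R₀`), lane G's charge-`13/25` ledger, T-F2 at `13/25` (the registered v8 texts, both keys), the faulted h-strip payer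
pool at `13/25` (registered v8 text), and the faulted residual CORE at `13/25`. -/
theorem bilayerWallV5_of_stubsResLast
    {sE : E3} (hsE : sE ∈ fccSlots) (hcert : ExactOnly 0 (fccSlots.filter fun w => 0 < ⟪w, sE⟫_ℝ))
    (hDS : ∀ F₁ F₂ : E3 ≃ₗᵢ[ℝ] E3, DoubleStarCoaxialAt F₁ F₂) (hCP : CapPairCoaxial) {R₀ : ℝ} (h10 : 10 ≤ R₀)
    (hF : ∃ C : ℝ, CoaxialUnifAt C R₀)
    (hG : ∃ K : ℝ, ∀ (P₁ : E3 ≃ₗᵢ[ℝ] E3) (t₁ : E3) (P₂ : E3 ≃ₗᵢ[ℝ] E3) (t₂ : E3),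
      ¬ (∃ (L : E3 ≃ₗᵢ[ℝ] E3) (r₁ r₂ : E3) (σ σ' : ℤ → ℤ), IsHaggSeq σ ∧ IsHaggSeq σ' ∧
        (fun p => P₁ p + t₁) '' fccStacking 1 (Real.sqrt (2 / 3)) ⊆
          (fun p => L p + r₁) '' barlowStacking 1 (Real.sqrt (2 / 3)) σ ∧
        (fun p => P₂ p + t₂) '' fccStacking 1 (Real.sqrt (2 / 3)) ⊆
          (fun p => L p + r₂) '' barlowStacking 1 (Real.sqrt (2 / 3)) σ') →
      GenericWallFloorWithCharge K R₀ (13 / 25) P₁ t₁ P₂ t₂)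
    (hFault : (∃ C : ℝ, BilayerWallFaultedOnReachCoaxialAt (13 / 25) C R₀) ∧
      (∃ C : ℝ, BilayerWallFaultedZigCoaxialAt (13 / 25) C R₀))
    (hPool : ∃ C : ℝ, HStripPayerPoolFaultedAt (13 / 25) C R₀)
    (hRes : ∃ C : ℝ, BilayerWallResidualFaultedCoreAt (13 / 25) C R₀) : BilayerWallV5 :=
  bilayerWallCharged_of_stubsResLast hsE hcert hDS hCP (by norm_num) (by norm_num) h10 hF hG hFault hPool hRes

end Summit.Ventures.Crystal3D.Cruxes.TextureLiminf.TexShadow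

end
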